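import Summits.BirchSwinnertonDyer.BirchSwinnertonDyer.Theorems.GenusKolyvaginAtTwoVisiblePairAtTwoDefs
import Literature.NumberTheory.EllipticCurves.CasselsTateSelmerPullback
import Literature.NumberTheory.EllipticCurves.KummerMap
import Literature.NumberTheory.EllipticCurves.PointDivisibilityProofs
import HarnessLib

/-!
# Route `GenusKolyvaginAtTwo`, crux `KolyvaginExactAtTwo` (22137) → Q3-inner (24882 / 27720):
# the KERNEL of a level pairing on `Ш(A/F)[2^L]` pulled back to `Sel_{2^M}(A/F)`, against Claims A and B

Seat `bsd-line-gk2-p2` g12 (cell `bsd-f1-sign2`). THEOREMS ONLY (no definition, no named fact, no `sorry`). Part 1 of 2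
(part 2: `…VisiblePairAtTwoCasselsTatePullback`, the instance and the capstone).

The capstone `selmer_eq_and_card_selmer_twin_eq_of_input_pair` (`…VisiblePairAtTwoInputPair`, p648690) displays the
Cassels–Tate data over `ℚ` as eight opaque hypotheses on two pairings `P₁`, `P₂` on `Sel_{2^M}(E/ℚ)`,
`Sel_{2^M}(E^{(d_K)}/ℚ)`; among them NON-DEGENERACY modulo `ℤx` (`hnd₁`) and NON-DEGENERACY (`hnd₂`), which for the
Cassels–Tate pairing pulled back to a Selmer group would classically be read off the finiteness of `Ш` and the rank.
Here they are derived WITHOUT any finiteness or rank input, for ANY level pairing `B` on `Ш(A/F)[2^L]`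
(`IsLevelPairing`: alternating, kernel `Ш[2^L] ∩ 2^L Ш` — Milne I Prop. 6.9 / Thm. 6.13(a)) pulled back along
`ι : Sel_{2^M}(A/F) → Ш(A/F)[2^L]`, from the descent's Claims A (`2^{M₀} Sel = 0`) / B (`2^{2M₀} Sel ⊆ ℤx`) and the
Kummer sequence (`A(F)[2] = 0`), over any number field `F` (the consumers take `F = ℚ`; generic `F` keeps the group law
on `A(F)` in the classical `DecidableEq` currency of the tree's Kummer files):

* §1 group lemmas: `pow_zsmul_eq_zero_of_lt` (a `p^M`-torsion killed by `p^E`, `E < M`, bounds every `p^k`-torsion),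
  `eq_zero_of_pow_zsmul_eq_zero`, `exists_eq_pow_zsmul_of_forall` (`2^a G ⊆ 2^b G`, `a < b`, no `2`-torsion ⟹
  `G = 2^k G`), `exists_eq_add_pow_zsmul_of_forall` (`2^E G ⊆ ℤx₀ + 2^M G`, `E < M`, `x₀ ∉ 2G` ⟹ `G = ℤx₀ + 2^k G`);
* §2 Kummer: `eq_zero_of_torsionH1ToH1_eq_zero_of_pow_zsmul_selmer` (Claim A ⟹ the kernel of
  `Sel_{2^M}(A/F) → H¹(F, A)` is `0`), `mem_zmultiples_of_torsionH1ToH1_eq_zero_of_selmer_le` (Claim B ⟹ it is `ℤx`);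
* §3 the maps `ι : Sel_{2^M} → Ш[2^L]` (`exists_selmerToSha`), their surjectivity for `L ≤ M`, and the kernel of a
  pulled-back level pairing (`torsionH1ToH1_eq_zero_of_forall_levelPairing_eq_zero`, granted `Ш[2^{2L}] ⊆ Ш[2^L]`).

BSD is not proved by any of this.

References: [McCallumLMS1991] W. G. McCallum, *Kolyvagin's work on Shafarevich–Tate groups*, LMS LNS 153 (1991),
§2 (1), §5 Thm. 5.4 (proof); [MilneADT2006] J. S. Milne, *Arithmetic Duality Theorems*, I §6 Prop. 6.9,
Thm. 6.13(a), (6.14); [SilvermanAEC2009] VIII §2, X §4 Thm. X.4.2(a).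
-/

set_option linter.dupNamespace false -- tree convention: `Summit.BirchSwinnertonDyer.BirchSwinnertonDyer.Theorems` (summit = sub-problem)
set_option autoImplicit false

noncomputable section

open scoped Classical
open scoped AddSubgroup

namespace Summit.BirchSwinnertonDyer.BirchSwinnertonDyer.Theorems.GenusExact.VisiblePairAtTwo

open WeierstrassCurve NumberField IsDedekindDomain Field Rat.HeightOneSpectrum
open Literature.NumberTheory.EllipticCurves Literature.NumberTheory.GaloisRepresentations
open Literature.NumberTheory.EllipticCurves.KolyvaginDescent
open Literature.GroupTheory.FiniteAbelian

/-! ## §1. Group lemmas -/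

section Group

variable {G : Type*} [AddCommGroup G]

/-- If the `p^M`-torsion of a subgroup `S` is killed by `p^E` with `E < M`, then ALL of its `p`-power torsion is
killed by `p^E` (strong induction on the exponent). [folklore] -/
theorem pow_zsmul_eq_zero_of_lt (S : AddSubgroup G) {p : ℤ} {E M : ℕ} (hEM : E < M)
    (h : ∀ a ∈ S, (p ^ M) • a = 0 → (p ^ E) • a = 0) :
    ∀ (k : ℕ), ∀ a ∈ S, (p ^ k) • a = 0 → (p ^ E) • a = 0 := by
  intro k
  induction k using Nat.strong_induction_on with
  | _ k ih =>
    intro a ha hk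
    by_cases hkM : k ≤ M
    · refine h a ha ?_
      rw [show M = (M - k) + k by omega, pow_add, mul_smul, hk, smul_zero]
    · have hk' : (p ^ M) • ((p ^ (k - M)) • a) = 0 := by
        rw [← mul_smul, ← pow_add, show M + (k - M) = k by omega]; exact hk
      have hE' := h _ (S.zsmul_mem ha _) hk'
      rw [← mul_smul, ← pow_add] at hE'
      exact ih (E + (k - M)) (by omega) a ha hE'

/-- No `p`-torsion implies no `p^k`-torsion. [folklore] -/
theorem eq_zero_of_pow_zsmul_eq_zero {p : ℤ} (hG : ∀ P : G, p • P = 0 → P = 0) (k : ℕ) (P : G)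
    (h : (p ^ k) • P = 0) : P = 0 := by
  induction k generalizing P with
  | zero => rwa [pow_zero, one_smul] at h
  | succ k ih =>
    rw [pow_succ, mul_smul] at h
    exact hG P (ih (p • P) h)

/-- If `2^a P` is `2^b`-divisible for every `P` (`a < b`) in a group without `2`-torsion, then every element is
`2^k`-divisible for every `k`. [folklore] -/
theorem exists_eq_pow_zsmul_of_forall (h2 : ∀ P : G, (2 : ℤ) • P = 0 → P = 0) {a b : ℕ} (hab : a < b)
    (h : ∀ P : G, ∃ Q : G, ((2 : ℤ) ^ a) • P = ((2 : ℤ) ^ b) • Q) (k : ℕ) (P : G) :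
    ∃ Q : G, P = ((2 : ℤ) ^ k) • Q := by
  -- every element is `2`-divisible
  have hdiv : ∀ P : G, ∃ Q : G, P = (2 : ℤ) • Q := by
    intro P
    obtain ⟨Q, hQ⟩ := h P
    refine ⟨((2 : ℤ) ^ (b - a - 1)) • Q, ?_⟩
    have h0 : ((2 : ℤ) ^ a) • (P - ((2 : ℤ) ^ (b - a)) • Q) = 0 := by
      rw [smul_sub, hQ, ← mul_smul, ← pow_add, show a + (b - a) = b by omega, sub_self]
    have h1 := eq_zero_of_pow_zsmul_eq_zero h2 a _ h0
    rw [sub_eq_zero] at h1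
    rw [h1, ← mul_smul, ← pow_succ', show b - a - 1 + 1 = b - a by omega]
  induction k generalizing P with
  | zero => exact ⟨P, by rw [pow_zero, one_smul]⟩
  | succ k ih =>
    obtain ⟨Q, hQ⟩ := ih P
    obtain ⟨Q', hQ'⟩ := hdiv Q
    exact ⟨Q', by rw [hQ, hQ', ← mul_smul, ← pow_succ]⟩

/-- If `2^E P ∈ ℤx₀ + 2^M G` for every `P` (`E < M`) in a group without `2`-torsion in which `x₀` is not
`2`-divisible, then `G = ℤx₀ + 2^k G` for every `k`. [folklore] -/
theorem exists_eq_add_pow_zsmul_of_forall (h2 : ∀ P : G, (2 : ℤ) • P = 0 → P = 0) (x₀ : G)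
    (hx₀ : ∀ y : G, (2 : ℤ) • y ≠ x₀) {E M : ℕ} (hEM : E < M)
    (h : ∀ P : G, ∃ (a : ℤ) (Q : G), ((2 : ℤ) ^ E) • P = a • x₀ + ((2 : ℤ) ^ M) • Q) (k : ℕ) (P : G) :
    ∃ (a : ℤ) (Q : G), P = a • x₀ + ((2 : ℤ) ^ k) • Q := by
  -- Step 1: every element lies in `ℤx₀ + 2G`
  have aux : ∀ e m : ℕ, e < m → ∀ P : G,
      (∃ (a : ℤ) (Q : G), ((2 : ℤ) ^ e) • P = a • x₀ + ((2 : ℤ) ^ m) • Q) →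
      ∃ (a : ℤ) (Q : G), P = a • x₀ + (2 : ℤ) • Q := by
    intro e
    induction e with
    | zero =>
      intro m hm P ⟨a, Q, hQ⟩
      rw [pow_zero, one_smul] at hQ
      exact ⟨a, ((2 : ℤ) ^ (m - 1)) • Q, by
        rw [hQ, ← mul_smul, ← pow_succ', show m - 1 + 1 = m by omega]⟩
    | succ e ih =>
      intro m hm P ⟨a, Q, hQ⟩
      have hQ' : (2 : ℤ) • (((2 : ℤ) ^ e) • P) = a • x₀ + (2 : ℤ) • (((2 : ℤ) ^ (m - 1)) • Q) := by
        rw [← mul_smul, ← pow_succ', ← mul_smul, ← pow_succ', show m - 1 + 1 = m by omega]; exact hQ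
      rcases Int.even_or_odd a with ⟨c, hc⟩ | ⟨c, hc⟩
      · -- `a = c + c`: divide by `2`
        have h0 : (2 : ℤ) • (((2 : ℤ) ^ e) • P - c • x₀ - ((2 : ℤ) ^ (m - 1)) • Q) = 0 := by
          rw [smul_sub, smul_sub, hQ', hc, add_smul]; abel
        have h1 := h2 _ h0
        rw [sub_sub, sub_eq_zero] at h1
        exact ih (m - 1) (by omega) P ⟨c, Q, h1⟩
      · -- `a = 2c + 1`: then `x₀` is `2`-divisible, contradiction
        exfalso
        refine hx₀ (((2 : ℤ) ^ e) • P - c • x₀ - ((2 : ℤ) ^ (m - 1)) • Q) ?_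
        rw [smul_sub, smul_sub, hQ', hc, add_smul, mul_smul, one_smul]; abel
  have hstep : ∀ P : G, ∃ (a : ℤ) (Q : G), P = a • x₀ + (2 : ℤ) • Q := fun P ↦ aux E M hEM P (h P)
  -- Step 2: induction on `k`
  induction k generalizing P with
  | zero => exact ⟨0, P, by rw [zero_smul, zero_add, pow_zero, one_smul]⟩
  | succ k ih =>
    obtain ⟨a, Q, hQ⟩ := ih P
    obtain ⟨a', Q', hQ'⟩ := hstep Q
    refine ⟨a + ((2 : ℤ) ^ k) * a', Q', ?_⟩
    rw [hQ, hQ', smul_add, ← mul_smul, ← mul_smul, ← pow_succ, add_smul]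
    abel

end Group

/-! ## §2. The Kummer sequence over `ℚ` against Claims A and B -/

section Kummer

-- Generic number field `F` (the consumers take `F = ℚ`): the group law on `A(F)` then carries the classical
-- `DecidableEq F` of the tree's Kummer files, not `instDecidableEqRat`.
variable {F : Type} [Field F] [NumberField F] (A : WeierstrassCurve F) [A.IsElliptic] (M : ℕ)

omit [NumberField F] [A.IsElliptic] in
/-- The level `2^M` is a nonzero integer. [folklore] -/
theorem lvl_ne_zero : (lvl M : ℤ) ≠ 0 := Int.natCast_ne_zero.mpr (pow_ne_zero M two_ne_zero)

/-- Every Kummer class `δ_M(P)`, `P ∈ A(F)`, lies in `Sel_{2^M}(A/F)`. [cite: SilvermanAEC2009, X.§4 Thm. X.4.2(a)] -/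
theorem kummerMapTorsion_mem_selmerGroup (P : A.toAffine.Point) :
    kummerMapTorsion A (lvl M) (A.zsmul_geomPoints_surjective_holds (lvl_ne_zero M)) P ∈
      selmerGroup A (lvl M) :=
  (mem_selmerGroup_iff A (lvl M) _).mpr
    ⟨fun _ ↦ kummerMapTorsion_mem_selmerLocalKer A (lvl M) _ _ P,
      fun _ ↦ kummerMapTorsion_mem_selmerLocalKer A (lvl M) _ _ P⟩

/-- `δ_M(P) = 0 ↔ P ∈ 2^M A(F)`, in `zsmul` form. [cite: SilvermanAEC2009, VIII.§2] -/
theorem kummerMapTorsion_eq_zero_iff (P : A.toAffine.Point) :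
    kummerMapTorsion A (lvl M) (A.zsmul_geomPoints_surjective_holds (lvl_ne_zero M)) P = 0 ↔
      ∃ Q : A.toAffine.Point, ((2 : ℤ) ^ M) • Q = P := by
  have h : P ∈ (kummerMapTorsion A (lvl M) (A.zsmul_geomPoints_surjective_holds (lvl_ne_zero M))).ker ↔
      P ∈ (zsmulAddGroupHom (α := A.toAffine.Point) (lvl M)).range := by
    rw [kummerMapTorsion_ker]
  rw [AddMonoidHom.mem_ker, AddMonoidHom.mem_range] at h
  rw [h]
  simp only [zsmulAddGroupHom_apply, lvl, Nat.cast_pow, Nat.cast_ofNat]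

/-- A class of `H¹(F, A[2^M])` dying in `H¹(F, A)` is a Kummer class. [cite: SilvermanAEC2009, VIII.§2] -/
theorem exists_kummerMapTorsion_eq_of_torsionH1ToH1_eq_zero {z : galH1Torsion A (lvl M)}
    (hz : torsionH1ToH1 A (lvl M) z = 0) :
    ∃ P : A.toAffine.Point,
      kummerMapTorsion A (lvl M) (A.zsmul_geomPoints_surjective_holds (lvl_ne_zero M)) P = z :=
  mem_range_kummerMapTorsion_of_torsionH1ToH1_eq_zero A (lvl M) _ z hz

variable {A M}

/-- **Claim A and the Kummer sequence: the kernel of `Sel_{2^M}(A/ℚ) → H¹(ℚ, A)` vanishes.** If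
`2^{M₀} · Sel_{2^M}(A/ℚ) = 0` with `M₀ < M` and `A(ℚ)[2] = 0`, then every class of `H¹(ℚ, A[2^M])` dying in
`H¹(ℚ, A)` is `0`: such a class is `δ_M(P)`, and `2^{M₀} A(ℚ) ⊆ 2^M A(ℚ)` forces `A(ℚ) = 2^M A(ℚ)` (no finiteness
of `A(ℚ)` or of `Ш` is used; stated over any number field `F`). [cite: McCallumLMS1991, §5 Thm. 5.4 (proof)]
[cite: SilvermanAEC2009, VIII.§2] -/
theorem eq_zero_of_torsionH1ToH1_eq_zero_of_pow_zsmul_selmer {M₀ : ℕ} (hM₀ : M₀ < M)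
    (h2 : ∀ P : A.toAffine.Point, 2 • P = 0 → P = 0)
    (hA : ∀ s ∈ selmerGroup A (lvl M), ((2 : ℤ) ^ M₀) • s = 0)
    {z : galH1Torsion A (lvl M)} (hz : torsionH1ToH1 A (lvl M) z = 0) : z = 0 := by
  have h2' : ∀ P : A.toAffine.Point, (2 : ℤ) • P = 0 → P = 0 := fun P hP ↦
    h2 P (by rw [← natCast_zsmul]; exact hP)
  set κ := kummerMapTorsion A (lvl M) (A.zsmul_geomPoints_surjective_holds (lvl_ne_zero M)) with hκ
  -- `2^{M₀} P ∈ 2^M A(ℚ)` for every `P`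
  have hdiv : ∀ P : A.toAffine.Point, ∃ Q : A.toAffine.Point,
      ((2 : ℤ) ^ M₀) • P = ((2 : ℤ) ^ M) • Q := by
    intro P
    have h0 : κ (((2 : ℤ) ^ M₀) • P) = 0 := by
      rw [map_zsmul]; exact hA _ (kummerMapTorsion_mem_selmerGroup A M P)
    obtain ⟨Q, hQ⟩ := (kummerMapTorsion_eq_zero_iff A M _).mp h0
    exact ⟨Q, hQ.symm⟩
  obtain ⟨P, rfl⟩ := exists_kummerMapTorsion_eq_of_torsionH1ToH1_eq_zero A M hz
  obtain ⟨Q, hQ⟩ := exists_eq_pow_zsmul_of_forall h2' hM₀ hdiv M P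
  exact (kummerMapTorsion_eq_zero_iff A M _).mpr ⟨Q, hQ.symm⟩

/-- **Claim B and the Kummer sequence: the kernel of `Sel_{2^M}(A/ℚ) → H¹(ℚ, A)` is `ℤx`.** If
`2^{2M₀} · Sel_{2^M}(A/ℚ) ⊆ ℤx` with `2M₀ < M`, `x` dies in `H¹(ℚ, A)` (`x = δ_M x₀`), `2^{M-1} x ≠ 0` and
`A(ℚ)[2] = 0`, then every class of `Sel_{2^M}(A/ℚ)` dying in `H¹(ℚ, A)` lies in `ℤx`: it is `δ_M(P)`, `x₀ ∉ 2A(ℚ)`,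
and `2^{2M₀} A(ℚ) ⊆ ℤx₀ + 2^M A(ℚ)` forces `A(ℚ) = ℤx₀ + 2^M A(ℚ)` (no finiteness of `A(ℚ)` or of `Ш` is used).
[cite: McCallumLMS1991, §5 Thm. 5.4 (proof)] [cite: SilvermanAEC2009, VIII.§2] -/
theorem mem_zmultiples_of_torsionH1ToH1_eq_zero_of_selmer_le {M₀ : ℕ} (hM₀ : 2 * M₀ < M)
    (h2 : ∀ P : A.toAffine.Point, 2 • P = 0 → P = 0)
    {x : galH1Torsion A (lvl M)} (hx : torsionH1ToH1 A (lvl M) x = 0) (hxord : ((2 : ℤ) ^ (M - 1)) • x ≠ 0)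
    (hB : ∀ s ∈ selmerGroup A (lvl M), ∃ a : ℤ, ((2 : ℤ) ^ (2 * M₀)) • s = a • x)
    {z : galH1Torsion A (lvl M)} (hz : torsionH1ToH1 A (lvl M) z = 0) :
    z ∈ AddSubgroup.zmultiples x := by
  have h2' : ∀ P : A.toAffine.Point, (2 : ℤ) • P = 0 → P = 0 := fun P hP ↦
    h2 P (by rw [← natCast_zsmul]; exact hP)
  set κ := kummerMapTorsion A (lvl M) (A.zsmul_geomPoints_surjective_holds (lvl_ne_zero M)) with hκ
  obtain ⟨x₀, rfl⟩ := exists_kummerMapTorsion_eq_of_torsionH1ToH1_eq_zero A M hx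
  -- `x₀ ∉ 2A(ℚ)`
  have hx₀ : ∀ y : A.toAffine.Point, (2 : ℤ) • y ≠ x₀ := by
    intro y hy
    apply hxord
    rw [← hy, map_zsmul, ← mul_smul, ← pow_succ, show M - 1 + 1 = M by omega]
    have h : ((2 : ℤ) ^ M) = lvl M := by simp [lvl]
    rw [h]
    exact zsmul_galH1Torsion_eq_zero A (lvl M) _
  -- `2^{2M₀} P ∈ ℤx₀ + 2^M A(ℚ)` for every `P`
  have hdiv : ∀ P : A.toAffine.Point, ∃ (a : ℤ) (Q : A.toAffine.Point),
      ((2 : ℤ) ^ (2 * M₀)) • P = a • x₀ + ((2 : ℤ) ^ M) • Q := by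
    intro P
    obtain ⟨a, ha⟩ := hB _ (kummerMapTorsion_mem_selmerGroup A M P)
    have h0 : κ (((2 : ℤ) ^ (2 * M₀)) • P - a • x₀) = 0 := by
      rw [map_sub, map_zsmul, map_zsmul, ha, sub_self]
    obtain ⟨Q, hQ⟩ := (kummerMapTorsion_eq_zero_iff A M _).mp h0
    exact ⟨a, Q, by rw [hQ]; abel⟩
  obtain ⟨P, rfl⟩ := exists_kummerMapTorsion_eq_of_torsionH1ToH1_eq_zero A M hz
  obtain ⟨a, Q, hQ⟩ := exists_eq_add_pow_zsmul_of_forall h2' x₀ hx₀ hM₀ hdiv M P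
  refine AddSubgroup.mem_zmultiples_iff.mpr ⟨a, ?_⟩
  have hQ0 : κ (((2 : ℤ) ^ M) • Q) = 0 := (kummerMapTorsion_eq_zero_iff A M _).mpr ⟨Q, rfl⟩
  rw [hQ, map_add, map_zsmul, hQ0, add_zero]

end Kummer

/-! ## §3. The maps `ι : Sel_{2^M} → Ш[2^L]` and the kernel of a pulled-back level pairing -/

section Pullback

variable {F : Type} [Field F] [NumberField F] (A : WeierstrassCurve F) [A.IsElliptic] (M L : ℕ)

omit [A.IsElliptic] in
/-- **The map `ι : Sel_{2^M}(A/F) → Ш(A/F)[2^L]`**, `z ↦` the image of `z` in `H¹(F, A)` — granted that `2^L`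
kills those images (`hkill`; for the consumers from Claims A/B, NOT from a finiteness statement).
[cite: MilneADT2006, Ch. I §6, (6.14) and Prop. 6.9] -/
theorem exists_selmerToSha
    (hkill : ∀ z ∈ selmerGroup A (lvl M), ((2 : ℤ) ^ L) • torsionH1ToH1 A (lvl M) z = 0) :
    ∃ ι : selmerGroup A (lvl M) →+ (A.sha)[(2 ^ L : ℕ)],
      ∀ z, shaTorsionVal A (2 ^ L) (ι z) = torsionH1ToH1 A (lvl M) z := by
  have hmem : ∀ z : selmerGroup A (lvl M), torsionH1ToH1 A (lvl M) z ∈ A.sha := fun z ↦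
    torsionH1ToH1_mem_sha_of_mem_selmerGroup (W := A) (lvl_ne_zero M) z.2
  have htor : ∀ z : selmerGroup A (lvl M),
      (⟨torsionH1ToH1 A (lvl M) z, hmem z⟩ : A.sha) ∈ (A.sha)[(2 ^ L : ℕ)] := fun z ↦
    mem_torsionBy_sha_of_zsmul_eq_zero A (2 ^ L) (hmem z) (by
      rw [Nat.cast_pow, Nat.cast_ofNat]; exact hkill z z.2)
  refine ⟨AddMonoidHom.mk' (fun z ↦ ⟨⟨torsionH1ToH1 A (lvl M) z, hmem z⟩, htor z⟩)
    (fun z₁ z₂ ↦ Subtype.ext (Subtype.ext ?_)), fun z ↦ rfl⟩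
  change torsionH1ToH1 A (lvl M) ((z₁ + z₂ : selmerGroup A (lvl M)) : galH1Torsion A (lvl M)) =
    torsionH1ToH1 A (lvl M) z₁ + torsionH1ToH1 A (lvl M) z₂
  rw [AddSubgroup.coe_add, map_add]

variable {A M L}
variable {R : Type*} [AddCommGroup R] (B : (A.sha)[(2 ^ L : ℕ)] →+ (A.sha)[(2 ^ L : ℕ)] →+ R)
  (ι : selmerGroup A (lvl M) →+ (A.sha)[(2 ^ L : ℕ)])
  (hι : ∀ z, shaTorsionVal A (2 ^ L) (ι z) = torsionH1ToH1 A (lvl M) z)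

omit [A.IsElliptic] in
include hι in
/-- `ι z = 0` iff `z` dies in `H¹(ℚ, A)`. [cite: SilvermanAEC2009, X.§4] -/
theorem selmerToSha_eq_zero_iff (z : selmerGroup A (lvl M)) : ι z = 0 ↔ torsionH1ToH1 A (lvl M) z = 0 := by
  rw [← hι z]
  exact ⟨fun h ↦ by rw [h]; rfl, fun h ↦ Subtype.ext (Subtype.ext h)⟩

include hι in
/-- **Every class of `Ш(A/ℚ)[2^L]` is `ι` of a class of `Sel_{2^M}(A/ℚ)`** (`L ≤ M`; Kummer sequence at level
`2^M`). [cite: SilvermanAEC2009, Thm X.4.2(a)] -/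
theorem selmerToSha_surjective (hLM : L ≤ M) : Function.Surjective ι := by
  intro y
  have hy : ((2 ^ M : ℕ) : ℤ) • shaTorsionVal A (2 ^ L) y = 0 := by
    rw [show 2 ^ M = 2 ^ (M - L) * 2 ^ L by rw [← pow_add, Nat.sub_add_cancel hLM], Nat.cast_mul, mul_smul,
      zsmul_shaTorsionVal, zsmul_zero]
  obtain ⟨t, ht, hty⟩ := exists_selmer_lift (W := A) (m := 2 ^ M) (shaTorsionVal_mem A (2 ^ L) y) hy
  refine ⟨⟨t, ht⟩, Subtype.ext (Subtype.ext ?_)⟩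
  change shaTorsionVal A (2 ^ L) (ι ⟨t, ht⟩) = shaTorsionVal A (2 ^ L) y
  rw [hι]
  exact hty

include hι in
/-- **The kernel of a pulled-back level pairing is the kernel of `Sel_{2^M} → H¹(ℚ, A)`**: if `B` is a level
pairing on `Ш(A/ℚ)[2^L]` (`IsLevelPairing`: kernel `Ш[2^L] ∩ 2^L Ш`, Milne I Thm. 6.13(a)), `L ≤ M`, and
`Ш(A/ℚ)[2^{2L}] ⊆ Ш(A/ℚ)[2^L]` (`hExp`), then `B(ι z, ι t) = 0` for all `t` forces `z` to die in `H¹(ℚ, A)`: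
the image `a = 2^L a₀` of `z` has `2^{2L} a₀ = 0`, hence `a = 2^L a₀ = 0`.
[cite: MilneADT2006, Ch. I §6, Thm. 6.13(a)] [cite: McCallumLMS1991, §5 Thm. 5.4 (proof)] -/
theorem torsionH1ToH1_eq_zero_of_forall_levelPairing_eq_zero (hB : IsLevelPairing (2 ^ L) B) (hLM : L ≤ M)
    (hExp : ∀ a ∈ A.sha, ((2 : ℤ) ^ (2 * L)) • a = 0 → ((2 : ℤ) ^ L) • a = 0)
    {z : selmerGroup A (lvl M)} (hz : ∀ t : selmerGroup A (lvl M), B (ι z) (ι t) = 0) :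
    torsionH1ToH1 A (lvl M) z = 0 := by
  have hall : ∀ y : (A.sha)[(2 ^ L : ℕ)], B (ι z) y = 0 := fun y ↦ by
    obtain ⟨t, rfl⟩ := selmerToSha_surjective ι hι hLM y
    exact hz t
  obtain ⟨a₀, ha₀⟩ := (hB.2 (ι z)).mp hall
  have h1 : ((2 ^ L : ℕ) : ℤ) • (a₀ : A.galH1) = (((ι z : (A.sha)[(2 ^ L : ℕ)]) : A.sha) : A.galH1) := by
    rw [natCast_zsmul, ← AddSubgroupClass.coe_nsmul, ha₀]
  have h2L : ((2 : ℤ) ^ (2 * L)) • (a₀ : A.galH1) = 0 := by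
    rw [two_mul, pow_add, mul_smul, show ((2 : ℤ) ^ L) = ((2 ^ L : ℕ) : ℤ) by simp, h1]
    exact zsmul_shaTorsionVal A (2 ^ L) (ι z)
  have hLa₀ : ((2 : ℤ) ^ L) • (a₀ : A.galH1) = 0 := hExp _ a₀.2 h2L
  rw [← hι z]
  change ((((ι z : (A.sha)[(2 ^ L : ℕ)]) : A.sha)) : A.galH1) = 0
  rw [← h1, show ((2 ^ L : ℕ) : ℤ) = (2 : ℤ) ^ L by simp]
  exact hLa₀

end Pullback

end Summit.BirchSwinnertonDyer.BirchSwinnertonDyer.Theorems.GenusExact.VisiblePairAtTwo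

end
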